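/-
Copyright: the b2b-balaban cell (near-miss cell 7), T⁴-continuum fan-out, lineage t4-ne7b-p1 (node U5c COUNT member).
Released under the licence of the surrounding project.
-/
import Summits.QuantumFields.BalabanUV.T4Continuum.Support.ZoneExtentLaw
import Summits.QuantumFields.BalabanUV.T4Continuum.Support.ZoneDiameter

/-!
# Zone reading: the (GM) side of NE7b as ONE TYPED SOCKET — a zone map with six reading facts

Summits-side support leaf of the T⁴-continuum cell (rung (B)+1 on a FINITE torus only; NOT infinite volume, NOT the
mass gap, NOT the Clay statement; NOT a proof of the spine estimate NE7b).  Lineage `t4-ne7b-p1` (generation 20),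
node U5c, wall (GM), located item G-ne7bp1g18-2 UPDATE-7.  [folklore] bookkeeping over the lineage's OWN carrier and
the torus geometry of `Support/ZoneDiameter.lean`; nothing is quoted from print and nothing printed is asserted; no
`[cite:]` tag.

WHAT.  The census lists what the reading (ID) must supply on the (GM) side in zone form: a ZONE MAP — for every
sub-structure `X` of the realized history `G : Gen PEv` and every step `t`, the finite set `zone t X` of level-`t`
block vectors it occupies on the torus `(ℤ∕nL^{K−t})^d` — with SIX READING FACTS.  This leaf TYPES that list as the
`Prop`-valued structure **`ZoneReading n L K Cb G zone`** (§3: in range; class-`d′` birth zone of diameter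
`≤ Cb·wtPEv b`; merged zone inside the union of the partners' zones; partners' zones SHARE a block at the merger; the
zone one step later inside the blocked zone; a renewal adds nothing) and PROVES that it is all the count needs:
* §3 **`zoneDyn_of_reading`**: the guarded realized diameter `extR` (the diameter of `zone t X` for sub-structures `X`
  of `G` formed by `t ≤ K`, `0` elsewhere) satisfies `ZoneExtentLaw.ZoneDyn PEv.step wtPEv σ Cb extR` for every
  `σ² ≥ 1∕L` (chronological `G`, `Cb ≥ 0`) — by `ZoneDiameter.diam_union_le_of_overlap` ∕ `diam_blocks_le_real`;
* §4 **`admZ_of_reading`**: the REALIZED placement `P₀` of the finite-alphabet restriction is zone-admissible for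
  `nearT n L K` with extents `extR`, given the two positional reading facts (root cells are cells of their root scale;
  at every merger the partners' root blocks lie in their zones) — by `ZoneDiameter.nearT_of_mem_overlap`;
* §5 **`card_admZSet_le_of_reading`**: hence (`ZoneExtentLaw.card_admZSet_grestrict_le_of_dyn`) the zone-admissible
  placements number at most `Kz^{#merges G}·(∏_{e ∈ merges G} Q(wcnt G,σ,step e)^d)·(L^d)^{partnerAges step G}` —
  `hlabZ`'s multiplicity factor — with `Kz = 2^d(C₀ + 2∕(1−σ²) + 1)^d`, `C₀ = max Cb (1∕(1−σ²)+1)`.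
§1–§2: the sub-structure relation `Sub` (well-formedness, chronology, events and `gmap` along it) and `diam_mono`.

SO THE (GM) WALL IS NOW A SOCKET: inhabit `ZoneReading` + the two positional facts + `Chrono` for Bałaban's histories
(the reading (ID), G-ne7bp1g9-1), and the multiplicity side of `hlabZ` follows by the theorems of this lineage; the
summation of the raw price over positioned histories and the per-record price (E2)∕(R1) (G-ne7bp1-1) remain.

HONEST DEPENDENCY (cell): continuum YM on T⁴ ⇐ BetaPertH ∧ nine spine estimates (0/9 proved); BetaPertH ⇐ (D1) ∧ (D4)
∧ CAP+tail.  This file changes none of it.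
-/

open Finset
open Literature.MathematicalPhysics.QuantumFieldTheory.Balaban1983to89
open T4PersistenceDictionary T4PartnerMultiplicity
open Summit.QuantumFields.BalabanUV.T4Continuum.PlacementSkeleton
open Summit.QuantumFields.BalabanUV.T4Continuum.Crowding
open Summit.QuantumFields.BalabanUV.T4Continuum.ZoneSkeleton
open Summit.QuantumFields.BalabanUV.T4Continuum.ZoneCrowd

namespace Summit.QuantumFields.BalabanUV.T4Continuum.ZoneTorus

noncomputable section

variable {ε ε' : Type*}

/-! ## §1 Sub-structures -/

/-- `Sub X G`: `X` is a sub-structure (a node) of the genealogy `G`. [folklore] -/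
inductive Sub : Gen ε → Gen ε → Prop
  | refl (G : Gen ε) : Sub G G
  | renew {X G : Gen ε} (e : ε) (h : ℕ) : Sub X G → Sub X (Gen.renew G e h)
  | left {X A : Gen ε} (B : Gen ε) (e : ε) : Sub X A → Sub X (Gen.merge A B e)
  | right {X B : Gen ε} (A : Gen ε) (e : ε) : Sub X B → Sub X (Gen.merge A B e)

/-- transitivity [folklore] -/
theorem Sub.trans : ∀ {X Y Z : Gen ε}, Sub X Y → Sub Y Z → Sub X Z
  | _, _, _, h₁, Sub.refl _ => h₁
  | _, _, _, h₁, Sub.renew e h hs => Sub.renew e h (Sub.trans h₁ hs)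
  | _, _, _, h₁, Sub.left B e hs => Sub.left B e (Sub.trans h₁ hs)
  | _, _, _, h₁, Sub.right A e hs => Sub.right A e (Sub.trans h₁ hs)

/-- sub-structures map to sub-structures [folklore] -/
theorem sub_gmap (f : ε → ε') : ∀ {X G : Gen ε}, Sub X G → Sub (gmap f X) (gmap f G)
  | _, _, Sub.refl _ => Sub.refl _
  | _, _, Sub.renew e h hs => Sub.renew (f e) h (sub_gmap f hs)
  | _, _, Sub.left B e hs => Sub.left (gmap f B) (f e) (sub_gmap f hs)
  | _, _, Sub.right A e hs => Sub.right (gmap f A) (f e) (sub_gmap f hs)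

/-- well-formedness descends to sub-structures [folklore] -/
theorem wf_of_sub [DecidableEq ε] (W : ε → ℕ) : ∀ {X G : Gen ε}, Sub X G → G.WF W → X.WF W
  | _, _, Sub.refl _, hW => hW
  | _, _, Sub.renew _ _ hs, hW => wf_of_sub W hs hW.1
  | _, _, Sub.left _ _ hs, hW => wf_of_sub W hs hW.1
  | _, _, Sub.right _ _ hs, hW => wf_of_sub W hs hW.2.1

/-- chronology descends to sub-structures [folklore] -/
theorem chrono_of_sub [DecidableEq ε] (st : ε → ℕ) : ∀ {X G : Gen ε}, Sub X G → Chrono st G → Chrono st X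
  | _, _, Sub.refl _, hc => hc
  | _, _, Sub.renew _ _ hs, hc => chrono_of_sub st hs hc
  | _, _, Sub.left _ _ hs, hc => chrono_of_sub st hs hc.1
  | _, _, Sub.right _ _ hs, hc => chrono_of_sub st hs hc.2.1

/-- events of a sub-structure are events of the whole [folklore] -/
theorem events_subset_of_sub [DecidableEq ε] : ∀ {X G : Gen ε}, Sub X G → X.events ⊆ G.events
  | _, _, Sub.refl _ => subset_rfl
  | _, _, Sub.renew e _ hs =>
      (events_subset_of_sub hs).trans (by rw [Gen.events_renew]; exact subset_insert _ _)
  | _, _, Sub.left B e hs =>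
      (events_subset_of_sub hs).trans (by rw [Gen.events_merge]; exact subset_union_left.trans (subset_insert _ _))
  | _, _, Sub.right A e hs =>
      (events_subset_of_sub hs).trans (by rw [Gen.events_merge]; exact subset_union_right.trans (subset_insert _ _))

/-! ## §2 The diameter is monotone -/

variable {d : ℕ}

/-- `A ⊆ B → diam m A ≤ diam m B` [folklore] -/
theorem diam_mono {m : ℕ} {A B : Finset (Fin d → ℕ)} (h : A ⊆ B) : diam m A ≤ diam m B :=
  diam_le_iff.2 fun _ hu _ hv => cdist_le_diam (h hu) (h hv)

/-! ## §3 The zone reading and the realized extent -/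

/-- **THE ZONE READING** of a realized history `G` on the cutoff-`K` torus (`n·L^K` sites a side): a zone map
`zone t X` (level-`t` block vectors occupied by the sub-structure `X` at step `t`) with the six reading facts of the
census — in range; birth zones of diameter `≤ Cb·wtPEv b`; merged zone inside the union of the partners' zones at the
merger step; the partners' zones SHARE a block there; one step later the zone lies inside the blocked zone; a renewal
adds nothing. [folklore] -/
structure ZoneReading (n L K : ℕ) (Cb : ℝ) (G : Gen PEv) (zone : ℕ → Gen PEv → Finset (Fin d → ℕ)) : Prop where
  /-- zones at step `t` live on `(ℤ∕nL^{K−t})^d` -/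
  inRange : ∀ (t : ℕ) (X : Gen PEv), Sub X G → InRange (n * L ^ (K - t)) (zone t X)
  /-- a birth's zone at its own step spans at most `Cb·wtPEv b` (= `Cb·(d′+1)` for a class-`d′` birth) -/
  birth : ∀ (b : PEv) (j : ℕ), Sub (Gen.born b j) G →
    (diam (n * L ^ (K - b.step)) (zone b.step (Gen.born b j)) : ℝ) ≤ Cb * wtPEv b
  /-- at the merger step the merged zone lies inside the union of the partners' zones -/
  union : ∀ (X Y : Gen PEv) (e : PEv), Sub (Gen.merge X Y e) G →
    zone e.step (Gen.merge X Y e) ⊆ zone e.step X ∪ zone e.step Y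
  /-- at the merger step the partners' zones share a block -/
  overlap : ∀ (X Y : Gen PEv) (e : PEv), Sub (Gen.merge X Y e) G → ∃ z, z ∈ zone e.step X ∧ z ∈ zone e.step Y
  /-- one step later (up to the cutoff) the zone lies inside the blocked zone -/
  step : ∀ (X : Gen PEv) (t : ℕ), Sub X G → ftime PEv.step X ≤ t → t + 1 ≤ K → zone (t + 1) X ⊆ blocks L (zone t X)
  /-- a renewal adds nothing to the zone -/
  renew : ∀ (X : Gen PEv) (e : PEv) (h t : ℕ), Sub (Gen.renew X e h) G → zone t (Gen.renew X e h) ⊆ zone t X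

section Ext

open scoped Classical

/-- THE REALIZED EXTENT (guarded): the diameter of `zone t X` for sub-structures `X` of `G` already formed at `t ≤ K`;
`0` elsewhere. [folklore] -/
def extR (n L K : ℕ) (G : Gen PEv) (zone : ℕ → Gen PEv → Finset (Fin d → ℕ)) (t : ℕ) (X : Gen PEv) : ℝ :=
  if Sub X G ∧ ftime PEv.step X ≤ t ∧ t ≤ K then (diam (n * L ^ (K - t)) (zone t X) : ℝ) else 0

/-- `extR ≥ 0` [folklore] -/
theorem extR_nonneg (n L K : ℕ) (G : Gen PEv) (zone : ℕ → Gen PEv → Finset (Fin d → ℕ)) (t : ℕ) (X : Gen PEv) :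
    0 ≤ extR n L K G zone t X := by
  unfold extR; split_ifs <;> positivity

/-- the realized extent on the guard [folklore] -/
theorem extR_of_guard {n L K : ℕ} {G : Gen PEv} {zone : ℕ → Gen PEv → Finset (Fin d → ℕ)} {t : ℕ} {X : Gen PEv}
    (h1 : Sub X G) (h2 : ftime PEv.step X ≤ t) (h3 : t ≤ K) :
    extR n L K G zone t X = (diam (n * L ^ (K - t)) (zone t X) : ℝ) := by
  simp [extR, h1, h2, h3]

/-- **THE READING GIVES THE DYNAMICS.**  For a chronological realized history, `Cb ≥ 0`, `L ≥ 1` and any `σ` with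
`1∕L ≤ σ²`: `ZoneDyn PEv.step wtPEv σ Cb (extR n L K G zone)`. [folklore] -/
theorem zoneDyn_of_reading {n L K : ℕ} (hL : 1 ≤ L) {Cb σ : ℝ} (hCb : 0 ≤ Cb) (hσL : 1 / (L : ℝ) ≤ σ ^ 2)
    {G : Gen PEv} (hchr : Chrono PEv.step G) {zone : ℕ → Gen PEv → Finset (Fin d → ℕ)}
    (hR : ZoneReading n L K Cb G zone) : ZoneDyn PEv.step wtPEv σ Cb (extR n L K G zone) := by
  have h0 : ∀ t X, 0 ≤ extR n L K G zone t X := extR_nonneg n L K G zone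
  refine ⟨fun b j => ?_, fun X Y e => ?_, fun X t hft => ?_, fun X e h t => ?_⟩
  · -- birth
    unfold extR
    split_ifs with hg
    · exact hR.birth b j hg.1
    · exact mul_nonneg hCb (wtPEv_nonneg b)
  · -- merge: union + overlap, at the merger step
    by_cases hg : Sub (Gen.merge X Y e) G ∧ ftime PEv.step (Gen.merge X Y e) ≤ e.step ∧ e.step ≤ K
    · obtain ⟨hsub, -, hK⟩ := hg
      have hsX : Sub X G := Sub.trans (Sub.left Y e (Sub.refl X)) hsub
      have hsY : Sub Y G := Sub.trans (Sub.right X e (Sub.refl Y)) hsub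
      obtain ⟨hfX, hfY⟩ := ftime_le_of_chrono PEv.step (chrono_of_sub PEv.step hsub hchr)
      rw [extR_of_guard (t := e.step) hsub le_rfl hK, extR_of_guard hsX hfX hK, extR_of_guard hsY hfY hK]
      obtain ⟨z, hzX, hzY⟩ := hR.overlap X Y e hsub
      have h1 := diam_mono (m := n * L ^ (K - e.step)) (hR.union X Y e hsub)
      have h2 := diam_union_le_of_overlap (hR.inRange _ X hsX) (hR.inRange _ Y hsY) hzX hzY
      have h3 : (diam (n * L ^ (K - e.step)) (zone e.step (Gen.merge X Y e)) : ℝ) ≤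
          diam (n * L ^ (K - e.step)) (zone e.step X) + diam (n * L ^ (K - e.step)) (zone e.step Y) := by
        exact_mod_cast h1.trans h2
      linarith
    · have : extR n L K G zone e.step (Gen.merge X Y e) = 0 := by rw [extR, if_neg hg]
      rw [this]; linarith [h0 e.step X, h0 e.step Y]
  · -- step: blocking contracts
    by_cases hg : Sub X G ∧ ftime PEv.step X ≤ t + 1 ∧ t + 1 ≤ K
    · obtain ⟨hsub, -, hK⟩ := hg
      have hK' : t ≤ K := Nat.le_of_succ_le hK
      rw [extR_of_guard hsub (Nat.le_succ_of_le hft) hK, extR_of_guard hsub hft hK']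
      have hm : n * L ^ (K - t) = n * L ^ (K - (t + 1)) * L := by
        rw [mul_assoc, ← pow_succ]; congr 2; omega
      have h1 := diam_mono (m := n * L ^ (K - (t + 1))) (hR.step X t hsub hft hK)
      have h2 := diam_blocks_le_real hL (n * L ^ (K - (t + 1))) (zone t X)
      rw [← hm] at h2
      have hD : (0 : ℝ) ≤ diam (n * L ^ (K - t)) (zone t X) := Nat.cast_nonneg _
      calc (diam (n * L ^ (K - (t + 1))) (zone (t + 1) X) : ℝ)
          ≤ diam (n * L ^ (K - (t + 1))) (blocks L (zone t X)) := by exact_mod_cast h1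
        _ ≤ 1 / (L : ℝ) * diam (n * L ^ (K - t)) (zone t X) + 1 := h2
        _ ≤ σ ^ 2 * diam (n * L ^ (K - t)) (zone t X) + 1 := by nlinarith
    · have : extR n L K G zone (t + 1) X = 0 := by rw [extR, if_neg hg]
      rw [this]; nlinarith [h0 t X, sq_nonneg σ]
  · -- renew: nothing added
    by_cases hg : Sub (Gen.renew X e h) G ∧ ftime PEv.step (Gen.renew X e h) ≤ t ∧ t ≤ K
    · obtain ⟨hsub, hft, hK⟩ := hg
      have hsX : Sub X G := Sub.trans (Sub.renew e h (Sub.refl X)) hsub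
      rw [extR_of_guard hsub hft hK, extR_of_guard hsX hft hK]
      exact_mod_cast diam_mono (hR.renew X e h t hsub)
    · have : extR n L K G zone t (Gen.renew X e h) = 0 := by rw [extR, if_neg hg]
      rw [this]; exact h0 t X

end Ext

/-! ## §4 The realized placement is zone-admissible -/

section Adm

open scoped Classical

/-- **THE REALIZED PLACEMENT IS ZONE-ADMISSIBLE.**  Let `G : Gen PEv` be chronological with events of step `≤ K`,
read by `ZoneReading n L K Cb G zone`, and `G' : Gen ↥E` a finite-alphabet genealogy with `gmap val G' = G` (e.g.
`grestrict E G hE`).  If the realized placement `P₀ : ↥E → TCell d (n·L^K)` puts every sub-structure's root on a cell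
of its root scale, and at every merger the partners' root blocks lie in their zones, then
`AdmZ (nearT n L K) (extR ∘ gmap val) (step ∘ val) G' P₀`. [folklore] -/
theorem admZ_of_reading {n L K : ℕ} {Cb : ℝ} {G : Gen PEv} (hchr : Chrono PEv.step G)
    (hK : ∀ e ∈ G.events, e.step ≤ K) {zone : ℕ → Gen PEv → Finset (Fin d → ℕ)} (hR : ZoneReading n L K Cb G zone)
    {E : Finset PEv} {G' : Gen ↥E} (hG : gmap Subtype.val G' = G) (P₀ : ↥E → TCell d (n * L ^ K))
    (hscale : ∀ X' : Gen ↥E, Sub X' G' → IsScale L X'.rootStep (P₀ X'.root))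
    (hroot : ∀ (X' Y' : Gen ↥E) (e' : ↥E), Sub (Gen.merge X' Y' e') G' →
      (fun i => (P₀ X'.root i).val / L ^ e'.1.step) ∈ zone e'.1.step (gmap Subtype.val X') ∧
      (fun i => (P₀ Y'.root i).val / L ^ e'.1.step) ∈ zone e'.1.step (gmap Subtype.val Y')) :
    AdmZ (nearT n L K) (fun t Z => extR n L K G zone t (gmap Subtype.val Z)) (PEv.step ∘ Subtype.val) G' P₀ := by
  suffices h : ∀ X' : Gen ↥E, Sub X' G' →
      AdmZ (nearT n L K) (fun t Z => extR n L K G zone t (gmap Subtype.val Z)) (PEv.step ∘ Subtype.val) X' P₀ from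
    h G' (Sub.refl _)
  intro X' hX'
  induction X' with
  | born b j => trivial
  | renew X e h ih => exact ih (Sub.trans (Sub.renew e h (Sub.refl X)) hX')
  | merge A B e ihA ihB =>
      have hsA : Sub A G' := Sub.trans (Sub.left B e (Sub.refl A)) hX'
      have hsB : Sub B G' := Sub.trans (Sub.right A e (Sub.refl B)) hX'
      refine ⟨ihA hsA, ihB hsB, ?_⟩
      -- the images in `G`
      have hsub : Sub (gmap Subtype.val (Gen.merge A B e)) G := hG ▸ sub_gmap Subtype.val hX'
      have hsubA : Sub (gmap Subtype.val A) G := hG ▸ sub_gmap Subtype.val hsA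
      have hsubB : Sub (gmap Subtype.val B) G := hG ▸ sub_gmap Subtype.val hsB
      have hchr' : Chrono PEv.step (Gen.merge (gmap Subtype.val A) (gmap Subtype.val B) e.1) :=
        chrono_of_sub PEv.step hsub hchr
      obtain ⟨hfA, hfB⟩ := ftime_le_of_chrono PEv.step hchr'
      have heK : e.1.step ≤ K := hK e.1 (events_subset_of_sub hsub (by simp [gmap]))
      -- the radius is the sum of the two realized diameters
      show nearT n L K (P₀ A.root) A.rootStep (P₀ B.root) B.rootStep e.1.step
        (extR n L K G zone e.1.step (gmap Subtype.val A) + extR n L K G zone e.1.step (gmap Subtype.val B))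
      rw [extR_of_guard hsubA hfA heK, extR_of_guard hsubB hfB heK]
      obtain ⟨z, hzA, hzB⟩ := hR.overlap _ _ e.1 hsub
      obtain ⟨hrA, hrB⟩ := hroot A B e hX'
      exact nearT_of_mem_overlap n L K heK (hscale A hsA) (hscale B hsB) (hR.inRange _ _ hsubA)
        (hR.inRange _ _ hsubB) hrA hrB hzA hzB

end Adm

/-! ## §5 The count from the reading -/

section Count

open scoped Classical

/-- **THE `hlabZ` MULTIPLICITY FACTOR FROM THE ZONE READING.**  For `G : Gen PEv` well-formed, chronological, with
kind-`0` births ∕ non-kind-`0` mergers, events in `E`, read by `ZoneReading n L K Cb G zone` (`Cb ≥ 0`), and any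
`0 ≤ σ < 1` with `1∕L ≤ σ²`: the zone-admissible torus placements of `grestrict E G hE` (extents `extR`) with the root
piece at `c` number at most `Kz^{#merges G}·(∏_{e ∈ merges G} Q(wcnt G,σ,step e)^(d:ℝ))·(L^d)^{partnerAges step G}`,
`Kz = 2^d(C₀ + 2∕(1−σ²) + 1)^d`, `C₀ = max Cb (1∕(1−σ²)+1)`. [folklore] -/
theorem card_admZSet_le_of_reading (W : PEv → ℕ) (n : ℕ) {L : ℕ} (hL : 1 ≤ L) (K : ℕ) {Cb σ : ℝ} (hCb : 0 ≤ Cb)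
    (h0 : 0 ≤ σ) (h1 : σ < 1) (hσL : 1 / (L : ℝ) ≤ σ ^ 2) {G : Gen PEv} (hW : G.WF W) (hchr : Chrono PEv.step G)
    (hk0 : ∀ b ∈ births G, b.kind = 0) (hk2 : ∀ m ∈ merges G, m.kind ≠ 0)
    {zone : ℕ → Gen PEv → Finset (Fin d → ℕ)} (hR : ZoneReading n L K Cb G zone)
    (E : Finset PEv) (hE : G.events ⊆ E) (c c₀' : TCell d (n * L ^ K)) :
    ((admZSet (nearT n L K) (fun t Z => extR n L K G zone t (gmap Subtype.val Z)) (PEv.step ∘ Subtype.val)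
        (grestrict E G hE) (grestrict E G hE).root c c₀').card : ℝ) ≤
      ((2 : ℝ) ^ d * (max Cb (1 / (1 - σ ^ 2) + 1) + 2 * (1 / (1 - σ ^ 2)) + 1) ^ d) ^ (merges G).card *
        (∏ e ∈ merges G, Q (wcnt G) σ e.step ^ (d : ℝ)) * ((L : ℝ) ^ d) ^ partnerAges PEv.step G :=
  card_admZSet_grestrict_le_of_dyn W n hL K (extR n L K G zone) (extR_nonneg n L K G zone) h0 h1
    (zoneDyn_of_reading hL hCb hσL hchr hR) hW hchr hk0 hk2 E hE c c₀'

end Count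

/-! ## §6 Sanity -/

namespace Sanity

/-- `Sub` on the two-leaf merger: the left leaf is a sub-structure -/
theorem sub_example : Sub (Gen.born (0 : ℕ) 0) (Gen.merge (Gen.born 0 0) (Gen.born 1 1) 2) :=
  Sub.left _ _ (Sub.refl _)

/-- the empty zone map reads any history with `Cb = 0` EXCEPT for the overlap fact — overlap is the one field that
forces the zones to be inhabited at mergers (a leaf has no merger, so it is read by the empty map) -/
theorem reading_leaf (n L K : ℕ) (b : PEv) (j : ℕ) :
    ZoneReading (d := 2) n L K 0 (Gen.born b j) (fun _ _ => ∅) := by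
  refine ⟨fun t X _ u hu => ?_, fun b' j' _ => ?_, fun X Y e h => ?_, fun X Y e h => ?_, fun X t _ _ _ => ?_,
    fun X e h t hs => ?_⟩
  · simp at hu
  · simp [diam]
  · cases h
  · cases h
  · simp
  · cases hs

end Sanity

end

end Summit.QuantumFields.BalabanUV.T4Continuum.ZoneTorus
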